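import Summits.MatrixMultiplication.OmegaCensus.STPPVosperTilingLaw
import Summits.MatrixMultiplication.OmegaCensus.STPPVosperTilingWordsEnum
import Summits.MatrixMultiplication.OmegaCensus.STPP222SqSymmetry
import Summits.MatrixMultiplication.OmegaCensus.STPPDisjointPacking

/-!
# ω-census (abelian STPP census): the EXTRACTION lemma for the exact-cover checker with words over a GENERAL sound enumerator (kernel, UNCONDITIONAL)

HONEST FRAMING (pub-omega census; verbatim): lottery ticket; floor = certified bounds/negative ranges.
Census STRUCTURE (seat pub-omega-stpp-1 gen 32, 2026-08-28), family (b2).  Tools for EXCLUDING candidate STPP block patterns of `ℤ/pℤ` by theorem;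
nothing here is progress on `ω`.

`existsCoverW_of_isSTPP_enum` is `existsCoverW_of_isSTPP` (`STPPVosperTilingWordsExtract.lean`) for an ARBITRARY sound block enumerator `bd`
(`BlockEnumSound p bd`, `STPPVosperTilingWordsEnum.lean`) in place of `blockDiffsW`; it is the words analogue of `coverSearch_of_isSTPP` (`STPPVosperCoverExtract.lean`, seat stpp-2 gen 25) with the SAME interface:
for an STPP family with non-empty sets, a block `i`, a duplicate-free list `ks` of the other indices, a unit `u` and base points `y₀, z₀`: if the values
`(u·(x − y₀)).val` of the points `x ∈ Y° = ⋃_{k≠i}(C_k − B_k)` are members of the duplicate-free list `YL` and every member of `YL` is such a value, and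
likewise for `Z° = ⋃_{k≠i}(C_k − A_k)`, `z₀`, `ZL`, then
`existsCoverW p YL ZL (ks.map fun k => bd YL ZL #A_k #B_k #C_k) [] [] [] = true` (`STPPVosperTilingWords.lean`).
So ANY law whose cover disjunct reads `coverSearch … = false` or `existsCover … = false` may use `existsCoverW … = false` instead (the Def-5.1 words among the
other blocks are enforced during the search), whatever the shapes of `Y°`, `Z°` (progression, almost-progression, two runs, …) encoded by `YL`, `ZL`.
Normalisation as in the tiling law: `B ↦ u(B − b*)`, `C ↦ u(C − b* − y₀)`, `A ↦ u(A − b* − y₀ + z₀)` per block; the word hypotheses of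
`existsCoverW_complete_enum` are instances of Def. 5.1 for the family.  `existsCoverW_both_of_isSTPP_enum`: the Z-first order (roles of the two rigid sets
exchanged, family `(B, A, C)`) is sound as well.

References: H. Cohn, R. Kleinberg, B. Szegedy, C. Umans, FOCS 2005 (arXiv:math/0511460), Def. 5.1.
-/

open Finset
open scoped Pointwise

namespace Summit.MatrixMultiplication.OmegaCensus.CubeNB

open Literature.Computability.AlgebraicComplexity
open Literature.Combinatorics.Additive
open Summit.MatrixMultiplication.OmegaCensus.STPPKneser

section Extract

variable {p : ℕ} [hp : Fact p.Prime] {N : ℕ} {A B C : Fin N → Finset (ZMod p)}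

/-- **Extraction for the checker with words.**  For an STPP family with non-empty sets, a block `i`, a duplicate-free list `ks` of the other indices,
a unit `u` and base points `y₀, z₀`: if the values `(u·(x − y₀)).val`, `x ∈ Y° = ⋃_{k≠i}(C_k − B_k)`, are members of the duplicate-free list `YL` and
every member of `YL` is such a value, and likewise for `Z° = ⋃_{k≠i}(C_k − A_k)`, `z₀`, `ZL`, then the exact-cover search with words succeeds.
[cite: CohnKleinbergSzegedyUmans2005, Def. 5.1] -/
theorem existsCoverW_of_isSTPP_enum {bd : List ℕ → List ℕ → ℕ → ℕ → ℕ → List (List ℕ × List ℕ × List ℕ)} (hbd : BlockEnumSound p bd)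
    (hS : IsSTPP A B C) (hA : ∀ k, (A k).Nonempty) (hB : ∀ k, (B k).Nonempty) (hC : ∀ k, (C k).Nonempty)
    (i : Fin N) (ks : List (Fin N)) (hks : ks.Nodup) (hksi : ∀ k, k ∈ ks ↔ k ≠ i) {u y₀ z₀ : ZMod p} (hu0 : u ≠ 0) {YL ZL : List ℕ}
    (hYL : YL.Nodup)
    (hY1 : ∀ x ∈ DU B C (univ.erase i), (u * (x - y₀)).val ∈ YL) (hY2 : ∀ t ∈ YL, ∃ x ∈ DU B C (univ.erase i), (u * (x - y₀)).val = t)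
    (hZ1 : ∀ x ∈ DU A C (univ.erase i), (u * (x - z₀)).val ∈ ZL) (hZ2 : ∀ t ∈ ZL, ∃ x ∈ DU A C (univ.erase i), (u * (x - z₀)).val = t) :
    existsCoverW p YL ZL (ks.map fun k => bd YL ZL #(A k) #(B k) #(C k)) [] [] [] = true := by
  set Yo := DU B C (univ.erase i) with hYo
  set Zo := DU A C (univ.erase i) with hZo
  have hbs : ∀ k, ∃ x, x ∈ B k := fun k => hB k
  choose bs hbsmem using hbs
  set φB : Fin N → ZMod p → ZMod p := fun k x => u * (x - bs k) with hφB
  set φC : Fin N → ZMod p → ZMod p := fun k x => u * (x - bs k - y₀) with hφC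
  set φA : Fin N → ZMod p → ZMod p := fun k x => u * (x - bs k - y₀ + z₀) with hφA
  have hinjB : ∀ k, Function.Injective (φB k) := fun k x x' h => by
    have := mul_left_cancel₀ hu0 h; simpa using this
  have hinjC : ∀ k, Function.Injective (φC k) := fun k x x' h => by
    have := mul_left_cancel₀ hu0 h; simpa using this
  have hinjA : ∀ k, Function.Injective (φA k) := fun k x x' h => by
    have := mul_left_cancel₀ hu0 h; simpa using this
  have hvinj : Function.Injective (ZMod.val : ZMod p → ℕ) := ZMod.val_injective p
  set Av : Fin N → Finset ℕ := fun k => (A k).image (fun x => (φA k x).val) with hAv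
  set Bv : Fin N → Finset ℕ := fun k => (B k).image (fun x => (φB k x).val) with hBv
  set Cv : Fin N → Finset ℕ := fun k => (C k).image (fun x => (φC k x).val) with hCv
  -- differences of normalised values
  have hdiffCB : ∀ k (c₀ b₀ : ZMod p), ((φC k c₀).val + p - (φB k b₀).val) % p = (u * (c₀ - b₀ - y₀)).val := by
    intro k c₀ b₀
    rw [← val_sub_eq_mod]
    congr 1
    simp only [hφC, hφB]; ring
  have hdiffCA : ∀ k (c₀ a₀ : ZMod p), ((φC k c₀).val + p - (φA k a₀).val) % p = (u * (c₀ - a₀ - z₀)).val := by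
    intro k c₀ a₀
    rw [← val_sub_eq_mod]
    congr 1
    simp only [hφC, hφA]; ring
  have hdiffAB : ∀ k (a₀ b₀ : ZMod p), ((φA k a₀).val + p - (φB k b₀).val) % p = (u * (a₀ - b₀ - y₀ + z₀)).val := by
    intro k a₀ b₀
    rw [← val_sub_eq_mod]
    congr 1
    simp only [hφA, hφB]; ring
  -- the three word values
  have hwordXZ : ∀ l k (a₁ b₁ c₂ a₂ : ZMod p),
      (((φA l a₁).val + p - (φB l b₁).val) % p + ((φC k c₂).val + p - (φA k a₂).val) % p) % p = (u * ((a₁ - b₁ + c₂ - a₂) - y₀)).val := by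
    intro l k a₁ b₁ c₂ a₂
    rw [hdiffAB, hdiffCA, ← ZMod.val_add]
    congr 1; ring
  have hwordYX : ∀ j' l (c₁ b₁ a₂ b₂ : ZMod p),
      (((φC j' c₁).val + p - (φB j' b₁).val) % p + p - ((φA l a₂).val + p - (φB l b₂).val) % p) % p =
        (u * ((c₁ - b₁ - a₂ + b₂) - z₀)).val := by
    intro j' l c₁ b₁ a₂ b₂
    rw [hdiffCB, hdiffAB, ← val_sub_eq_mod]
    congr 1; ring
  have hwordYZ : ∀ j' k (c₁ b₁ c₂ a₂ : ZMod p),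
      (((φC j' c₁).val + p - (φB j' b₁).val) % p + p - ((φC k c₂).val + p - (φA k a₂).val) % p) % p =
        (u * ((c₁ - b₁ - c₂ + a₂) - y₀ + z₀)).val := by
    intro j' k c₁ b₁ c₂ a₂
    rw [hdiffCB, hdiffCA, ← val_sub_eq_mod]
    congr 1; ring
  -- membership of difference-set elements in Y° / Z°, and back from values to points
  have hYmem : ∀ k, k ≠ i → ∀ c₀ ∈ C k, ∀ b₀ ∈ B k, c₀ - b₀ ∈ Yo := fun k hk c₀ hc₀ b₀ hb₀ =>
    D_subset_DU (Finset.mem_erase.2 ⟨hk, Finset.mem_univ k⟩) (mem_D.2 ⟨b₀, hb₀, c₀, hc₀, rfl⟩)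
  have hZmem : ∀ k, k ≠ i → ∀ c₀ ∈ C k, ∀ a₀ ∈ A k, c₀ - a₀ ∈ Zo := fun k hk c₀ hc₀ a₀ ha₀ =>
    D_subset_DU (Finset.mem_erase.2 ⟨hk, Finset.mem_univ k⟩) (mem_D.2 ⟨a₀, ha₀, c₀, hc₀, rfl⟩)
  have hYL_to_Yo : ∀ w : ZMod p, (u * (w - y₀)).val ∈ YL → w ∈ Yo := by
    intro w hw
    obtain ⟨x, hx, hxw⟩ := hY2 _ hw
    have h1 : x = w := by have := mul_left_cancel₀ hu0 (hvinj hxw); linear_combination this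
    exact h1 ▸ hx
  have hZL_to_Zo : ∀ w : ZMod p, (u * (w - z₀)).val ∈ ZL → w ∈ Zo := by
    intro w hw
    obtain ⟨x, hx, hxw⟩ := hZ2 _ hw
    have h1 : x = w := by have := mul_left_cancel₀ hu0 (hvinj hxw); linear_combination this
    exact h1 ▸ hx
  have hYo_D : ∀ w ∈ Yo, ∃ k'', k'' ≠ i ∧ ∃ b₀ ∈ B k'', ∃ c₀ ∈ C k'', c₀ - b₀ = w := by
    intro w hw
    obtain ⟨k'', hk'', hwk⟩ := Finset.mem_biUnion.1 hw
    exact ⟨k'', (Finset.mem_erase.1 hk'').1, mem_D.1 hwk⟩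
  have hZo_D : ∀ w ∈ Zo, ∃ k'', k'' ≠ i ∧ ∃ a₀ ∈ A k'', ∃ c₀ ∈ C k'', c₀ - a₀ = w := by
    intro w hw
    obtain ⟨k'', hk'', hwk⟩ := Finset.mem_biUnion.1 hw
    exact ⟨k'', (Finset.mem_erase.1 hk'').1, mem_D.1 hwk⟩
  have hiA : ∀ k, Function.Injective (fun x => (φA k x).val) := fun k x x' h => hinjA k (hvinj h)
  have hiB : ∀ k, Function.Injective (fun x => (φB k x).val) := fun k x x' h => hinjB k (hvinj h)
  have hiC : ∀ k, Function.Injective (fun x => (φC k x).val) := fun k x x' h => hinjC k (hvinj h)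
  -- run the sound search
  refine existsCoverW_complete_enum (p := p) hbd (YL := YL) (ZL := ZL) hYL (fun k => k ≠ i) (fun k => (#(A k), #(B k), #(C k))) Av Bv Cv
    (fun k _ => by simp only [hAv]; rw [Finset.card_image_of_injective _ (hiA k)])
    (fun k _ => by simp only [hBv]; rw [Finset.card_image_of_injective _ (hiB k)])
    (fun k _ => by simp only [hCv]; rw [Finset.card_image_of_injective _ (hiC k)])
    (fun k x hx => by obtain ⟨y, -, rfl⟩ := Finset.mem_image.1 hx; exact ZMod.val_lt _)
    (fun k x hx => by obtain ⟨y, -, rfl⟩ := Finset.mem_image.1 hx; exact ZMod.val_lt _)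
    (fun k x hx => by obtain ⟨y, -, rfl⟩ := Finset.mem_image.1 hx; exact ZMod.val_lt _)
    (fun k _ => Finset.mem_image.2 ⟨bs k, hbsmem k, by simp [hφB]⟩)
    ?hY ?hZ ?hinjY ?hinjZ ?hinjX ?hdY ?hdZ ?hdX ?hwXZ ?hwYX ?hwYZ ?hcY ?hcZ ks hks hksi
  case hY =>
    intro k hk c hc x hx
    obtain ⟨c₀, hc₀, rfl⟩ := Finset.mem_image.1 hc
    obtain ⟨b₀, hb₀, rfl⟩ := Finset.mem_image.1 hx
    rw [hdiffCB k c₀ b₀]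
    exact hY1 _ (hYmem k hk c₀ hc₀ b₀ hb₀)
  case hZ =>
    intro k hk c hc x hx
    obtain ⟨c₀, hc₀, rfl⟩ := Finset.mem_image.1 hc
    obtain ⟨a₀, ha₀, rfl⟩ := Finset.mem_image.1 hx
    rw [hdiffCA k c₀ a₀]
    exact hZ1 _ (hZmem k hk c₀ hc₀ a₀ ha₀)
  case hinjY =>
    intro k _ c hc c' hc' x hx x' hx' heq
    obtain ⟨c₀, hc₀, rfl⟩ := Finset.mem_image.1 hc
    obtain ⟨c₁, hc₁, rfl⟩ := Finset.mem_image.1 hc'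
    obtain ⟨b₀, hb₀, rfl⟩ := Finset.mem_image.1 hx
    obtain ⟨b₁, hb₁, rfl⟩ := Finset.mem_image.1 hx'
    rw [hdiffCB k c₀ b₀, hdiffCB k c₁ b₁] at heq
    have h1 : c₀ - b₀ = c₁ - b₁ := by
      have := mul_left_cancel₀ hu0 (hvinj heq); linear_combination this
    obtain ⟨e1, e2⟩ := sub_injOn_of_card_D (card_D_BC hS hA k) hb₀ hb₁ hc₀ hc₁ h1
    exact ⟨by rw [e2], by rw [e1]⟩
  case hinjZ =>
    intro k _ c hc c' hc' x hx x' hx' heq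
    obtain ⟨c₀, hc₀, rfl⟩ := Finset.mem_image.1 hc
    obtain ⟨c₁, hc₁, rfl⟩ := Finset.mem_image.1 hc'
    obtain ⟨a₀, ha₀, rfl⟩ := Finset.mem_image.1 hx
    obtain ⟨a₁, ha₁, rfl⟩ := Finset.mem_image.1 hx'
    rw [hdiffCA k c₀ a₀, hdiffCA k c₁ a₁] at heq
    have h1 : c₀ - a₀ = c₁ - a₁ := by
      have := mul_left_cancel₀ hu0 (hvinj heq); linear_combination this
    obtain ⟨e1, e2⟩ := sub_injOn_of_card_D (card_D_AC hS hB k) ha₀ ha₁ hc₀ hc₁ h1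
    exact ⟨by rw [e2], by rw [e1]⟩
  case hinjX =>
    intro k _ c hc c' hc' x hx x' hx' heq
    obtain ⟨a₀, ha₀, rfl⟩ := Finset.mem_image.1 hc
    obtain ⟨a₁, ha₁, rfl⟩ := Finset.mem_image.1 hc'
    obtain ⟨b₀, hb₀, rfl⟩ := Finset.mem_image.1 hx
    obtain ⟨b₁, hb₁, rfl⟩ := Finset.mem_image.1 hx'
    rw [hdiffAB k a₀ b₀, hdiffAB k a₁ b₁] at heq
    have h1 : b₀ - a₀ = b₁ - a₁ := by
      have := mul_left_cancel₀ hu0 (hvinj heq); linear_combination (-1 : ZMod p) * this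
    obtain ⟨e1, e2⟩ := sub_injOn_of_card_D (card_D_AB hS hC k) ha₀ ha₁ hb₀ hb₁ h1
    exact ⟨by rw [e1], by rw [e2]⟩
  case hdY =>
    intro k k' hk hk' hne c hc x hx c' hc' x' hx' heq
    obtain ⟨c₀, hc₀, rfl⟩ := Finset.mem_image.1 hc
    obtain ⟨b₀, hb₀, rfl⟩ := Finset.mem_image.1 hx
    obtain ⟨c₁, hc₁, rfl⟩ := Finset.mem_image.1 hc'
    obtain ⟨b₁, hb₁, rfl⟩ := Finset.mem_image.1 hx'
    rw [hdiffCB k c₀ b₀, hdiffCB k' c₁ b₁] at heq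
    have h1 : c₀ - b₀ = c₁ - b₁ := by
      have := mul_left_cancel₀ hu0 (hvinj heq); linear_combination this
    have hm0 : c₀ - b₀ ∈ D B C k := mem_D.2 ⟨b₀, hb₀, c₀, hc₀, rfl⟩
    have hm1 : c₁ - b₁ ∈ D B C k' := mem_D.2 ⟨b₁, hb₁, c₁, hc₁, rfl⟩
    rw [h1] at hm0
    exact Finset.disjoint_left.1 (disjoint_D_BC hS hA hne) hm0 hm1
  case hdZ =>
    intro k k' hk hk' hne c hc x hx c' hc' x' hx' heq
    obtain ⟨c₀, hc₀, rfl⟩ := Finset.mem_image.1 hc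
    obtain ⟨a₀, ha₀, rfl⟩ := Finset.mem_image.1 hx
    obtain ⟨c₁, hc₁, rfl⟩ := Finset.mem_image.1 hc'
    obtain ⟨a₁, ha₁, rfl⟩ := Finset.mem_image.1 hx'
    rw [hdiffCA k c₀ a₀, hdiffCA k' c₁ a₁] at heq
    have h1 : c₀ - a₀ = c₁ - a₁ := by
      have := mul_left_cancel₀ hu0 (hvinj heq); linear_combination this
    have hm0 : c₀ - a₀ ∈ D A C k := mem_D.2 ⟨a₀, ha₀, c₀, hc₀, rfl⟩
    have hm1 : c₁ - a₁ ∈ D A C k' := mem_D.2 ⟨a₁, ha₁, c₁, hc₁, rfl⟩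
    rw [h1] at hm0
    exact Finset.disjoint_left.1 (disjoint_D_AC hS hB hne) hm0 hm1
  case hdX =>
    intro k k' hk hk' hne c hc x hx c' hc' x' hx' heq
    obtain ⟨a₀, ha₀, rfl⟩ := Finset.mem_image.1 hc
    obtain ⟨b₀, hb₀, rfl⟩ := Finset.mem_image.1 hx
    obtain ⟨a₁, ha₁, rfl⟩ := Finset.mem_image.1 hc'
    obtain ⟨b₁, hb₁, rfl⟩ := Finset.mem_image.1 hx'
    rw [hdiffAB k a₀ b₀, hdiffAB k' a₁ b₁] at heq
    have h1 : b₀ - a₀ = b₁ - a₁ := by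
      have := mul_left_cancel₀ hu0 (hvinj heq); linear_combination (-1 : ZMod p) * this
    have hm0 : b₀ - a₀ ∈ D A B k := mem_D.2 ⟨a₀, ha₀, b₀, hb₀, rfl⟩
    have hm1 : b₁ - a₁ ∈ D A B k' := mem_D.2 ⟨a₁, ha₁, b₁, hb₁, rfl⟩
    rw [h1] at hm0
    exact Finset.disjoint_left.1 (disjoint_D_AB hS hC hne) hm0 hm1
  case hwXZ =>
    -- `(a₁ − b₁) + (c₂ − a₂) ∈ Y°` forces the same block and `a₁ = a₂` (Def. 5.1 with indices `(l, k″, k)`)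
    intro l k hl hk x₁ hx₁ y₁ hy₁ c hc x₂ hx₂ hne hmem
    obtain ⟨a₁, ha₁, rfl⟩ := Finset.mem_image.1 hx₁
    obtain ⟨b₁, hb₁, rfl⟩ := Finset.mem_image.1 hy₁
    obtain ⟨c₂, hc₂, rfl⟩ := Finset.mem_image.1 hc
    obtain ⟨a₂, ha₂, rfl⟩ := Finset.mem_image.1 hx₂
    rw [hwordXZ l k a₁ b₁ c₂ a₂] at hmem
    obtain ⟨k'', -, b₃, hb₃, c₃, hc₃, h3⟩ := hYo_D _ (hYL_to_Yo _ hmem)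
    obtain ⟨h1, h2, h4, -, -⟩ := hS l k'' k a₂ ha₂ a₁ ha₁ b₁ hb₁ b₃ hb₃ c₃ hc₃ c₂ hc₂ (by linear_combination (-1 : ZMod p) * h3)
    have hlk : l = k := h1.trans h2
    subst hlk
    exact hne ⟨rfl, by rw [h4]⟩
  case hwYX =>
    -- `(c₁ − b₁) − (a₂ − b₂) ∈ Z°` forces the same block and `b₁ = b₂` (indices `(l, j, k″)`)
    intro j' l hj' hl c hc y₁ hy₁ x hx y₂ hy₂ hne hmem
    obtain ⟨c₁, hc₁, rfl⟩ := Finset.mem_image.1 hc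
    obtain ⟨b₁, hb₁, rfl⟩ := Finset.mem_image.1 hy₁
    obtain ⟨a₂, ha₂, rfl⟩ := Finset.mem_image.1 hx
    obtain ⟨b₂, hb₂, rfl⟩ := Finset.mem_image.1 hy₂
    rw [hwordYX j' l c₁ b₁ a₂ b₂] at hmem
    obtain ⟨k'', -, a₃, ha₃, c₃, hc₃, h3⟩ := hZo_D _ (hZL_to_Zo _ hmem)
    obtain ⟨h1, -, -, h4, -⟩ := hS l j' k'' a₃ ha₃ a₂ ha₂ b₂ hb₂ b₁ hb₁ c₁ hc₁ c₃ hc₃ (by linear_combination h3)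
    subst h1
    exact hne ⟨rfl, by rw [h4]⟩
  case hwYZ =>
    -- `(c₁ − b₁) − (c₂ − a₂) = a₃ − b₃` forces all three blocks equal and `c₁ = c₂` (indices `(l, j, k)`)
    intro j' k l hj' hk hl c hc y₁ hy₁ c' hc' x hx x' hx' y' hy' hne heq
    obtain ⟨c₁, hc₁, rfl⟩ := Finset.mem_image.1 hc
    obtain ⟨b₁, hb₁, rfl⟩ := Finset.mem_image.1 hy₁
    obtain ⟨c₂, hc₂, rfl⟩ := Finset.mem_image.1 hc'
    obtain ⟨a₂, ha₂, rfl⟩ := Finset.mem_image.1 hx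
    obtain ⟨a₃, ha₃, rfl⟩ := Finset.mem_image.1 hx'
    obtain ⟨b₃, hb₃, rfl⟩ := Finset.mem_image.1 hy'
    rw [hwordYZ j' k c₁ b₁ c₂ a₂, hdiffAB l a₃ b₃] at heq
    have h3 : c₁ - b₁ - c₂ + a₂ = a₃ - b₃ := by
      have := mul_left_cancel₀ hu0 (hvinj heq); linear_combination this
    obtain ⟨h1, h2, -, -, h5⟩ := hS l j' k a₂ ha₂ a₃ ha₃ b₃ hb₃ b₁ hb₁ c₁ hc₁ c₂ hc₂ (by linear_combination (-1 : ZMod p) * h3)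
    subst h1; subst h2
    exact hne ⟨rfl, rfl, by rw [h5]⟩
  case hcY =>
    intro y hyin
    obtain ⟨w, hw, rfl⟩ := hY2 y hyin
    obtain ⟨k, hk, b₀, hb₀, c₀, hc₀, hcb⟩ := hYo_D _ hw
    refine ⟨k, hk, (φC k c₀).val, Finset.mem_image.2 ⟨c₀, hc₀, rfl⟩, (φB k b₀).val, Finset.mem_image.2 ⟨b₀, hb₀, rfl⟩, ?_⟩
    rw [hdiffCB k c₀ b₀, hcb]
  case hcZ =>
    intro t ht
    obtain ⟨w, hw, rfl⟩ := hZ2 t ht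
    obtain ⟨k, hk, a₀, ha₀, c₀, hc₀, hca⟩ := hZo_D _ hw
    refine ⟨k, hk, (φC k c₀).val, Finset.mem_image.2 ⟨c₀, hc₀, rfl⟩, (φA k a₀).val, Finset.mem_image.2 ⟨a₀, ha₀, rfl⟩, ?_⟩
    rw [hdiffCA k c₀ a₀, hca]

/-- **Both search orders are sound.**  Under the hypotheses of `existsCoverW_of_isSTPP_enum` (with `ZL` duplicate-free as well) the Y-first search AND the
Z-first search (the same family read as `(B, A, C)` — `isSTPP_swapBC (stpp_rotate hS)` — with the roles of the two rigid sets exchanged) return `true`.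
[cite: CohnKleinbergSzegedyUmans2005, Def. 5.1] -/
theorem existsCoverW_both_of_isSTPP_enum {bd : List ℕ → List ℕ → ℕ → ℕ → ℕ → List (List ℕ × List ℕ × List ℕ)}
    (hbd : BlockEnumSound p bd) (hS : IsSTPP A B C) (hA : ∀ k, (A k).Nonempty) (hB : ∀ k, (B k).Nonempty)
    (hC : ∀ k, (C k).Nonempty) (i : Fin N) (ks : List (Fin N)) (hks : ks.Nodup) (hksi : ∀ k, k ∈ ks ↔ k ≠ i) {u y₀ z₀ : ZMod p} (hu0 : u ≠ 0)
    {YL ZL : List ℕ} (hYL : YL.Nodup) (hZL : ZL.Nodup)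
    (hY1 : ∀ x ∈ DU B C (univ.erase i), (u * (x - y₀)).val ∈ YL) (hY2 : ∀ t ∈ YL, ∃ x ∈ DU B C (univ.erase i), (u * (x - y₀)).val = t)
    (hZ1 : ∀ x ∈ DU A C (univ.erase i), (u * (x - z₀)).val ∈ ZL) (hZ2 : ∀ t ∈ ZL, ∃ x ∈ DU A C (univ.erase i), (u * (x - z₀)).val = t) :
    existsCoverW p YL ZL (ks.map fun k => bd YL ZL #(A k) #(B k) #(C k)) [] [] [] = true ∧
      existsCoverW p ZL YL (ks.map fun k => bd ZL YL #(B k) #(A k) #(C k)) [] [] [] = true :=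
  ⟨existsCoverW_of_isSTPP_enum hbd hS hA hB hC i ks hks hksi hu0 hYL hY1 hY2 hZ1 hZ2,
    existsCoverW_of_isSTPP_enum hbd (STPP222SqNeg.isSTPP_swapBC (stpp_rotate hS)) hB hA hC i ks hks hksi hu0 hZL hZ1 hZ2 hY1 hY2⟩

end Extract

end Summit.MatrixMultiplication.OmegaCensus.CubeNB
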